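import Summits.QuantumFields.BalabanUV.Beta.FP.NestedStepLawJetsCorner
import Summits.QuantumFields.BalabanUV.Beta.FP.NestedSliceExchange
import Literature.MathematicalPhysics.QuantumFieldTheory.Balaban1983to89.Beta.SliceComposition

/-!
# The ONE-SHOT-sliced composite step: slice exchange, then the nested step law with the corner killed (road «FP», route T, row (T-INST-j) — the integration theorem)

Owner file of road «FP» (unit `b2b-balaban-beta-d1-p3`, gen 17), rulings R-FP-51 («ROUTE T») and R-FP-52 («comb coordinates; (SX-STEP) ≡ 0»), memo
`N2B-DESIGN.md` v5.2 §20 (20d).  The road's level-`(j, m+1)` composite system is sliced ONE-SHOT (one comb slice `P` on the fine fields), whereas the model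
theorem that factorises exactly — `NestedStepLawJetsCorner.secondVar_nestedStepLaw_corner` — is sliced NESTEDLY (`[τ₂Q₁; τ₁]`: block comb slice on the block
average, fine comb slice).  `NestedSliceExchange.secondVar_kkt_slice_change_of_const` exchanges the two slices at the level of second variations as soon as
both Faddeev–Popov factors have CONSTANT modulus along the background curve, and `NestedSliceExchange.det_nestedSlice_mul_gauge'` (LEMMA N) factors the nested
one into the two one-step factors.  This file COMPOSES the three, in CURVE form (the form the torus identification row (T-ID) instantiates at the finite index
types `KernelPeriodisationFib.Idx M F` of the periodised level-`j` tables):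

* §1 plumbing: `secondVar` is invariant under re-indexing (`secondVar_submatrix_equiv`); regrouping ∕ re-indexing the slice rows of a bordered 2-jet does not
  change its second variation (`secondVar_kkt_fromRows_assoc`, `secondVar_kkt_fromRows_reindex` — the latter lets a consumer present its one-shot slice with
  rows indexed by any `ρ ≃ ρ₂ ⊕ ρ₁`); the composite averaging kills the residual gauge generators (`compAveraging_mul_gauge_eq_zero`); the nested comb
  Faddeev–Popov factor has modulus `c₂·c₁` (`abs_det_nestedSlice_mul_gauge`); the nested-sliced composite system is non-degenerate as soon as the fine sliced
  system and the COARSE SLICED system are (`det_kkt_compSliced_ne_zero`).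
* §2 **`secondVar_oneShot_nestedStepLaw`**.  DATA: `C²` curves `H` (fine form), `Q₁` (one-step averaging), `Q₂` (coarse averaging), `G` (block term), `P` (the
  ONE-SHOT slice, rows `ρ₂ ⊕ ρ₁`) near `0` with first-jet curves and second jets at `0`; STATIC comb slices `τ₁` (fine, rows `ρ₁`), `τ₂` (block, rows `ρ₂`); gauge
  generators `D₁` (fine-residual parameters `ρ₁`), `D₂` (block parameters `ρ₂`) on the fine fields and `D̄` (the induced coarse generators) — NO regularity asked
  of them; near `0`: COVARIANCE `Q₁D₁ = 0`, `Q₁D₂ = D̄`, `Q₂D̄ = 0`; GAUGE INVARIANCE OF THE COMPOSITE FORM ON `ker Q₂Q₁` (`(H + Q₁ᵀGQ₁)·[D₂|D₁] = (Q₂Q₁)ᵀ·Y`, same for the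
  transpose — an3's (F2)); (UNI) the three Faddeev–Popov factors `τ₁D₁`, `τ₂D̄`, `P·[D₂|D₁]` of CONSTANT non-zero modulus (comb ∕ tree slices on the torus —
  an3's THEOREM R (4), to be supplied by the (T-ID) ∕ unimodularity holders); (INV) the fine sliced system `kkt H₀ [Q₁₀;τ₁]` and the COARSE SLICED system
  `kkt (𝔊₁₁ + G₀) [Q₂₀;τ₂]` non-degenerate at `0`.  CONCLUSION: the second variation at `0` of `log|det|` of the ONE-SHOT-sliced composite system
  `kkt (H + Q₁ᵀGQ₁) [Q₂Q₁; P]` along the curve (every jet displayed) = that of the fine one-step sliced system + that of the COARSE SLICED system with the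
  transported jets of `secondVar_nestedStepLaw_corner` (every jet displayed).  ZERO STEP DEFECT; the slice exchange is free ((SX-STEP) ≡ 0).

What is NOT here (rows of other holders, R-FP-51∕52): the identification of the road's periodised packed kernels and insertion families with these curves
((T-ID): tables, corners, insertions, dictionary), torus unimodularity of the comb slices ((UNI) discharged), (T-INV) at levels `j`, `j+1` ((INV) discharged),
de-periodisation `M → ∞` and `j → ∞`, polarisation (`SecondVarPolarisation`), ASSEMBLY′ with TAD.
HONEST: finite-dimensional calculus at model level, every index type generic; nothing here is the road's (SDF), (D1), BetaPertH, a continuum statement or Clay.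
HONEST DEPENDENCY: continuum YM on T⁴ ⇐ BetaPertH ∧ nine spine estimates (0/9 proved); BetaPertH ⇐ (D1) ∧ (D4) ∧ CAP+tail; G-an2-4 gates asym, D1 and NE2/3/4.
Orientation only (nothing quoted is load-bearing): nested axial gauge fixing of composite renormalization transformations and the background-independence of
axial Faddeev–Popov factors are the subject of [Balaban1987RG1] §1 (1.17)–(1.22) pp. 262–264; this file's content is textbook calculus of `log|det|`.
-/

noncomputable section

namespace Summit.QuantumFields.BalabanUV.Beta.FP.NestedStepLawOneShot

open Matrix Filter Finset
open scoped Topology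
open Literature.MathematicalPhysics.QuantumFieldTheory.Balaban1983to89.Beta.Composition (kkt compForm)
open Literature.MathematicalPhysics.QuantumFieldTheory.Balaban1983to89.Beta.CompositionSingular (effForm flucCov minOp minOpL)
open Literature.MathematicalPhysics.QuantumFieldTheory.Balaban1983to89.Beta.SliceComposition (kkt_reindex det_kkt_reindex fromRows_assoc)
open Summit.QuantumFields.BalabanUV.Beta.D1BFx.LogDetSecondVariation (secondVar)
open Summit.QuantumFields.BalabanUV.Beta.D1BFx.SliceTransferModel (hasDerivAt_matMul)
open Summit.QuantumFields.BalabanUV.Beta.FP.NestedStepLawMovingBorder (det_kkt_comp_ne_zero hasDerivAt_compForm_curves_jet hasDerivAt_mul_curves_jet)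
open Summit.QuantumFields.BalabanUV.Beta.FP.NestedStepLawSliced (nestedSlice_mul_fromRows compForm_fromRows_blockDiag hasDerivAt_fromRows_const)
open Summit.QuantumFields.BalabanUV.Beta.FP.NestedStepLawJets (hasDerivAt_const_mul hasDerivAt_compFormSliced)
open Summit.QuantumFields.BalabanUV.Beta.FP.KKTCornerReduction (det_kkt_killRows)
open Summit.QuantumFields.BalabanUV.Beta.FP.NestedStepLawJetsCorner (toBlocks₁₁_add_blockDiag secondVar_nestedStepLaw_corner)
open Summit.QuantumFields.BalabanUV.Beta.FP.NestedSliceExchange (det_nestedSlice_mul_gauge' secondVar_kkt_slice_change_of_const)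

/-! ## §1 Plumbing: re-indexing, the residual gauge generators under the composite averaging, the nested comb FP factor, non-degeneracy -/

section Reindex

variable {ι ι' : Type*} [Fintype ι] [Fintype ι'] [DecidableEq ι] [DecidableEq ι']

omit [DecidableEq ι] [DecidableEq ι'] in
/-- [folklore] the trace is invariant under re-indexing by an equivalence. -/
theorem trace_submatrix_equiv (e : ι' ≃ ι) (M : Matrix ι ι ℝ) : (M.submatrix e e).trace = M.trace := by
  simp only [Matrix.trace, Matrix.diag_apply, Matrix.submatrix_apply]
  exact e.sum_comp (fun j => M j j)

/-- [folklore] **`secondVar` IS INVARIANT UNDER SIMULTANEOUS RE-INDEXING OF THE 2-JET BY AN EQUIVALENCE**: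
`secondVar (A₀∘e) (A₁∘e) (A₂∘e) = secondVar A₀ A₁ A₂` (`tr`, `⁻¹`, `·` commute with `submatrix e e`). -/
theorem secondVar_submatrix_equiv (e : ι' ≃ ι) (A₀ A₁ A₂ : Matrix ι ι ℝ) :
    secondVar (A₀.submatrix e e) (A₁.submatrix e e) (A₂.submatrix e e) = secondVar A₀ A₁ A₂ := by
  unfold secondVar
  rw [Matrix.inv_submatrix_equiv, Matrix.submatrix_mul_equiv, Matrix.submatrix_mul_equiv, Matrix.submatrix_mul_equiv, trace_submatrix_equiv,
    trace_submatrix_equiv]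

end Reindex

section Rows

variable {ν κ ρ ρ' ρ₁ ρ₂ : Type*} [Fintype ν] [Fintype κ] [Fintype ρ] [Fintype ρ'] [Fintype ρ₁] [Fintype ρ₂]
  [DecidableEq ν] [DecidableEq κ] [DecidableEq ρ] [DecidableEq ρ'] [DecidableEq ρ₁] [DecidableEq ρ₂]

omit [Fintype ν] [Fintype κ] [Fintype ρ] [Fintype ρ'] [Fintype ρ₁] [Fintype ρ₂] [DecidableEq ν] [DecidableEq κ] [DecidableEq ρ] [DecidableEq ρ']
  [DecidableEq ρ₁] [DecidableEq ρ₂] in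
/-- [folklore] re-indexing the slice rows re-indexes the stacked border along `1 ⊕ e`. -/
theorem fromRows_submatrix_right (A : Matrix κ ν ℝ) (P : Matrix ρ ν ℝ) (e : ρ' ≃ ρ) :
    fromRows A (P.submatrix e id) = (fromRows A P).submatrix (Equiv.sumCongr (Equiv.refl κ) e) id := by
  ext (i | i) j <;> rfl

omit [Fintype ρ₁] [Fintype ρ₂] [DecidableEq ρ₁] [DecidableEq ρ₂] in
/-- [folklore] **RE-INDEXING THE SLICE ROWS OF A BORDERED 2-JET DOES NOT CHANGE ITS SECOND VARIATION** — a consumer whose one-shot slice has rows indexed by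
any `ρ` with `e : ρ' ≃ ρ` reads §2 (stated for rows `ρ₂ ⊕ ρ₁`) through this. -/
theorem secondVar_kkt_fromRows_reindex (K₀ K₁ K₂ : Matrix ν ν ℝ) (A₀ A₁ A₂ : Matrix κ ν ℝ) (P₀ P₁ P₂ : Matrix ρ ν ℝ) (e : ρ' ≃ ρ) :
    secondVar (kkt K₀ (fromRows A₀ (P₀.submatrix e id))) (kkt K₁ (fromRows A₁ (P₁.submatrix e id))) (kkt K₂ (fromRows A₂ (P₂.submatrix e id)))
      = secondVar (kkt K₀ (fromRows A₀ P₀)) (kkt K₁ (fromRows A₁ P₁)) (kkt K₂ (fromRows A₂ P₂)) := by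
  rw [fromRows_submatrix_right, fromRows_submatrix_right, fromRows_submatrix_right, kkt_reindex, kkt_reindex, kkt_reindex, secondVar_submatrix_equiv]

omit [Fintype ρ] [Fintype ρ'] [DecidableEq ρ] [DecidableEq ρ'] in
/-- [folklore] **REGROUPING THE SLICE ROWS** `[A; [B; C]] ↔ [[A; B]; C]` of a bordered 2-jet does not change its second variation. -/
theorem secondVar_kkt_fromRows_assoc (K₀ K₁ K₂ : Matrix ν ν ℝ) (A₀ A₁ A₂ : Matrix κ ν ℝ) (B₀ B₁ B₂ : Matrix ρ₂ ν ℝ) (C₀ C₁ C₂ : Matrix ρ₁ ν ℝ) :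
    secondVar (kkt K₀ (fromRows A₀ (fromRows B₀ C₀))) (kkt K₁ (fromRows A₁ (fromRows B₁ C₁))) (kkt K₂ (fromRows A₂ (fromRows B₂ C₂)))
      = secondVar (kkt K₀ (fromRows (fromRows A₀ B₀) C₀)) (kkt K₁ (fromRows (fromRows A₁ B₁) C₁)) (kkt K₂ (fromRows (fromRows A₂ B₂) C₂)) := by
  rw [fromRows_assoc, fromRows_assoc, fromRows_assoc, kkt_reindex, kkt_reindex, kkt_reindex, secondVar_submatrix_equiv]

end Rows

section Gauge

variable {ν μ κ ρ₁ ρ₂ : Type*} [Fintype ν] [Fintype μ] [Fintype κ] [Fintype ρ₁] [Fintype ρ₂]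
  [DecidableEq ν] [DecidableEq μ] [DecidableEq κ] [DecidableEq ρ₁] [DecidableEq ρ₂]

omit [Fintype κ] [Fintype ρ₁] [Fintype ρ₂] [DecidableEq ν] [DecidableEq μ] [DecidableEq κ] [DecidableEq ρ₁] [DecidableEq ρ₂] in
/-- [folklore] **THE COMPOSITE AVERAGING KILLS THE RESIDUAL GAUGE GENERATORS**: `Q₁D₁ = 0`, `Q₁D₂ = D̄`, `Q₂D̄ = 0` ⇒ `(Q₂Q₁)·[D₂|D₁] = 0`. -/
theorem compAveraging_mul_gauge_eq_zero (Q₁ : Matrix μ ν ℝ) (Q₂ : Matrix κ μ ℝ) (D₁ : Matrix ν ρ₁ ℝ) (D₂ : Matrix ν ρ₂ ℝ) (Dbar : Matrix μ ρ₂ ℝ)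
    (h₁ : Q₁ * D₁ = 0) (h₂ : Q₁ * D₂ = Dbar) (h₃ : Q₂ * Dbar = 0) :
    Q₂ * Q₁ * fromCols D₂ D₁ = 0 := by
  rw [Matrix.mul_fromCols, Matrix.mul_assoc, Matrix.mul_assoc, h₁, h₂, h₃, Matrix.mul_zero, Matrix.fromCols_zero]

omit [Fintype κ] [DecidableEq ν] [DecidableEq μ] [DecidableEq κ] in
/-- [folklore] **THE NESTED COMB FADDEEV–POPOV FACTOR HAS MODULUS `c₂·c₁`** (LEMMA N `det_nestedSlice_mul_gauge'`, absolute values). -/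
theorem abs_det_nestedSlice_mul_gauge (τ₁ : Matrix ρ₁ ν ℝ) (τ₂ : Matrix ρ₂ μ ℝ) (Q₁ : Matrix μ ν ℝ) (D₁ : Matrix ν ρ₁ ℝ) (D₂ : Matrix ν ρ₂ ℝ)
    (Dbar : Matrix μ ρ₂ ℝ) {c₁ c₂ : ℝ} (h₁ : Q₁ * D₁ = 0) (h₂ : Q₁ * D₂ = Dbar) (hc₁ : |(τ₁ * D₁).det| = c₁) (hc₂ : |(τ₂ * Dbar).det| = c₂) :
    |(fromRows (τ₂ * Q₁) τ₁ * fromCols D₂ D₁).det| = c₂ * c₁ := by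
  rw [det_nestedSlice_mul_gauge' τ₁ τ₂ Q₁ D₁ D₂ Dbar h₁ h₂, abs_mul, hc₁, hc₂]

/-- [folklore] **THE NESTED-SLICED COMPOSITE SYSTEM IS NON-DEGENERATE** as soon as the fine sliced system `kkt H [Q₁;τ₁]` and the COARSE SLICED system
`kkt (𝔊₁₁ + G) [Q₂;τ₂]` (`𝔊 = effForm H [Q₁;τ₁]`) are: `det_kkt_comp_ne_zero` (moving-border factorisation) + `det_kkt_killRows` (the `ρ₁`-corner). -/
theorem det_kkt_compSliced_ne_zero (H : Matrix ν ν ℝ) (Q₁ : Matrix μ ν ℝ) (Q₂ : Matrix κ μ ℝ) (G : Matrix μ μ ℝ) (τ₁ : Matrix ρ₁ ν ℝ) (τ₂ : Matrix ρ₂ μ ℝ)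
    {S : Matrix (μ ⊕ ρ₁) (μ ⊕ ρ₁) ℝ} (hS : effForm H (fromRows Q₁ τ₁) = S) (h1 : (kkt H (fromRows Q₁ τ₁)).det ≠ 0)
    (h2 : (kkt (S.toBlocks₁₁ + G) (fromRows Q₂ τ₂)).det ≠ 0) :
    (kkt (H + Q₁ᵀ * G * Q₁) (fromRows (fromRows (Q₂ * Q₁) (τ₂ * Q₁)) τ₁)).det ≠ 0 := by
  have h2' : (kkt (effForm H (fromRows Q₁ τ₁) + fromBlocks G (0 : Matrix μ ρ₁ ℝ) (0 : Matrix ρ₁ μ ℝ) (0 : Matrix ρ₁ ρ₁ ℝ))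
      (fromBlocks (fromRows Q₂ τ₂) (0 : Matrix (κ ⊕ ρ₂) ρ₁ ℝ) (0 : Matrix ρ₁ μ ℝ) (1 : Matrix ρ₁ ρ₁ ℝ))).det ≠ 0 := by
    rw [hS, det_kkt_killRows, toBlocks₁₁_add_blockDiag]
    exact mul_ne_zero (pow_ne_zero _ (by norm_num)) h2
  have h := det_kkt_comp_ne_zero H (fromRows Q₁ τ₁) (fromBlocks G (0 : Matrix μ ρ₁ ℝ) (0 : Matrix ρ₁ μ ℝ) (0 : Matrix ρ₁ ρ₁ ℝ))
    (fromBlocks (fromRows Q₂ τ₂) (0 : Matrix (κ ⊕ ρ₂) ρ₁ ℝ) (0 : Matrix ρ₁ μ ℝ) (1 : Matrix ρ₁ ρ₁ ℝ)) h1 h2'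
  rwa [compForm_fromRows_blockDiag, nestedSlice_mul_fromRows] at h

end Gauge

/-! ## §2 The one-shot-sliced composite step law -/

section Law

variable {ν μ κ ρ₁ ρ₂ : Type*} [Fintype ν] [Fintype μ] [Fintype κ] [Fintype ρ₁] [Fintype ρ₂]
  [DecidableEq ν] [DecidableEq μ] [DecidableEq κ] [DecidableEq ρ₁] [DecidableEq ρ₂]

/-- [folklore] **THE ONE-SHOT-SLICED COMPOSITE STEP LAW (route T's (T-INST-j) integration theorem, curve form).**  DATA: `C²` curves `H, Q₁, Q₂, G` (as in
`NestedStepLawJets.secondVar_nestedStepLaw_jets`) and `P` (the ONE-SHOT slice, rows `ρ₂ ⊕ ρ₁`) near `0` with first-jet curves `H₁, Q₁d, Q₂d, Gd, Pd` and second jets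
`H₂, Q₁dd, Q₂dd, Gdd, Pdd` at `0`; STATIC comb slices `τ₁` (fine), `τ₂` (block); gauge generators `D₁, D₂` (fine fields; fine-residual ∕ block parameters) and `D̄` (block
fields), multiplier letters `Y, Y'` — no regularity; near `0`: COVARIANCE `Q₁D₁ = 0`, `Q₁D₂ = D̄`, `Q₂D̄ = 0`; GAUGE INVARIANCE ON `ker Q₂Q₁` of the composite form
`𝔎 = H + Q₁ᵀGQ₁`: `𝔎·[D₂|D₁] = (Q₂Q₁)ᵀY`, `𝔎ᵀ·[D₂|D₁] = (Q₂Q₁)ᵀY'`; (UNI) `|det(τ₁D₁)| ≡ c₁`, `|det(τ₂D̄)| ≡ c₂`, `|det(P·[D₂|D₁])| ≡ c'`, all non-zero; values and first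
jets at `0` NAMED (`H₀, H₁₀, Q₁₀, Q₁₁, Q₂₀, Q₂₁, G₀, G₁, P₀, P₁`); the blocks `Γ, 𝓘, 𝓘ᴸ, 𝔊` of the inverse of the fine sliced system `kkt H₀ [Q₁₀;τ₁]` and `B = [Q₁₁;0]` NAMED;
(INV) `det kkt H₀ [Q₁₀;τ₁] ≠ 0`, `det kkt (𝔊₁₁ + G₀) [Q₂₀;τ₂] ≠ 0`.
CONCLUSION: `secondVar` of the ONE-SHOT-sliced composite 2-jet `(kkt (H₀ + Q₁₀ᵀG₀Q₁₀) [Q₂₀Q₁₀; P₀], kkt 𝔎̇ [(Q₂Q₁)˙; P₁], kkt 𝔎̈ [(Q₂Q₁)¨; Pdd])` (composite jets written out)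
`=` `secondVar` of the fine one-step sliced 2-jet `(kkt H₀ [Q₁₀;τ₁], kkt H₁₀ B, kkt H₂ [Q₁dd;0])` `+` `secondVar` of the COARSE SLICED 2-jet
`(kkt (𝔊₁₁ + G₀) [Q₂₀;τ₂], kkt (((𝓘ᴸH₁₀ − 𝔊B)𝓘 − 𝓘ᴸBᵀ𝔊)₁₁ + G₁) [Q₂₁;0], kkt ((second-jet word)₁₁ + Gdd) [Q₂dd;0])`.
PROOF: `secondVar_kkt_slice_change_of_const` (one-shot slice `P` ↦ nested comb slice `[τ₂Q₁; τ₁]`, FP moduli `c'` and `c₂c₁` by §1) ∘ `secondVar_kkt_fromRows_assoc` ∘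
`secondVar_nestedStepLaw_corner` at the jets at `0`. -/
theorem secondVar_oneShot_nestedStepLaw
    {H H₁ : ℝ → ν → ν → ℝ} {H₂ : Matrix ν ν ℝ} {Q₁ Q₁d : ℝ → μ → ν → ℝ} {Q₁dd : Matrix μ ν ℝ} {Q₂ Q₂d : ℝ → κ → μ → ℝ} {Q₂dd : Matrix κ μ ℝ}
    {G Gd : ℝ → μ → μ → ℝ} {Gdd : Matrix μ μ ℝ} {P Pd : ℝ → (ρ₂ ⊕ ρ₁) → ν → ℝ} {Pdd : Matrix (ρ₂ ⊕ ρ₁) ν ℝ}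
    (hH : ∀ᶠ u in 𝓝 (0 : ℝ), HasDerivAt H (H₁ u) u) (hH₁ : HasDerivAt H₁ (Matrix.of.symm H₂) 0)
    (hQ₁ : ∀ᶠ u in 𝓝 (0 : ℝ), HasDerivAt Q₁ (Q₁d u) u) (hQ₁d : HasDerivAt Q₁d (Matrix.of.symm Q₁dd) 0)
    (hQ₂ : ∀ᶠ u in 𝓝 (0 : ℝ), HasDerivAt Q₂ (Q₂d u) u) (hQ₂d : HasDerivAt Q₂d (Matrix.of.symm Q₂dd) 0)
    (hG : ∀ᶠ u in 𝓝 (0 : ℝ), HasDerivAt G (Gd u) u) (hGd : HasDerivAt Gd (Matrix.of.symm Gdd) 0)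
    (hP : ∀ᶠ u in 𝓝 (0 : ℝ), HasDerivAt P (Pd u) u) (hPd : HasDerivAt Pd (Matrix.of.symm Pdd) 0)
    (τ₁ : Matrix ρ₁ ν ℝ) (τ₂ : Matrix ρ₂ μ ℝ)
    -- gauge generators, covariance of the two averagings, gauge invariance of the composite form on `ker Q₂Q₁`, constant-modulus FP factors
    {D₁ : ℝ → ν → ρ₁ → ℝ} {D₂ : ℝ → ν → ρ₂ → ℝ} {Dbar : ℝ → μ → ρ₂ → ℝ} {Y Y' : ℝ → κ → (ρ₂ ⊕ ρ₁) → ℝ} {c₁ c₂ c' : ℝ}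
    (hQD₁ : ∀ᶠ u in 𝓝 (0 : ℝ), Matrix.of (Q₁ u) * Matrix.of (D₁ u) = 0)
    (hQD₂ : ∀ᶠ u in 𝓝 (0 : ℝ), Matrix.of (Q₁ u) * Matrix.of (D₂ u) = Matrix.of (Dbar u))
    (hQDbar : ∀ᶠ u in 𝓝 (0 : ℝ), Matrix.of (Q₂ u) * Matrix.of (Dbar u) = 0)
    (hKW : ∀ᶠ u in 𝓝 (0 : ℝ), (Matrix.of (H u) + (Matrix.of (Q₁ u))ᵀ * Matrix.of (G u) * Matrix.of (Q₁ u)) * fromCols (Matrix.of (D₂ u)) (Matrix.of (D₁ u))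
      = (Matrix.of (Q₂ u) * Matrix.of (Q₁ u))ᵀ * Matrix.of (Y u))
    (hKtW : ∀ᶠ u in 𝓝 (0 : ℝ), (Matrix.of (H u) + (Matrix.of (Q₁ u))ᵀ * Matrix.of (G u) * Matrix.of (Q₁ u))ᵀ * fromCols (Matrix.of (D₂ u)) (Matrix.of (D₁ u))
      = (Matrix.of (Q₂ u) * Matrix.of (Q₁ u))ᵀ * Matrix.of (Y' u))
    (hU₁ : ∀ᶠ u in 𝓝 (0 : ℝ), |(τ₁ * Matrix.of (D₁ u)).det| = c₁) (hU₂ : ∀ᶠ u in 𝓝 (0 : ℝ), |(τ₂ * Matrix.of (Dbar u)).det| = c₂)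
    (hU' : ∀ᶠ u in 𝓝 (0 : ℝ), |(Matrix.of (P u) * fromCols (Matrix.of (D₂ u)) (Matrix.of (D₁ u))).det| = c')
    (hc₁ : c₁ ≠ 0) (hc₂ : c₂ ≠ 0) (hc' : c' ≠ 0)
    -- values and first jets at `0`, NAMED
    {H₀ H₁₀ : Matrix ν ν ℝ} {Q₁₀ Q₁₁ : Matrix μ ν ℝ} {Q₂₀ Q₂₁ : Matrix κ μ ℝ} {G₀ G₁ : Matrix μ μ ℝ} {P₀ P₁ : Matrix (ρ₂ ⊕ ρ₁) ν ℝ}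
    (hH₀ : Matrix.of (H 0) = H₀) (hH₁₀ : Matrix.of (H₁ 0) = H₁₀) (hQ₁₀ : Matrix.of (Q₁ 0) = Q₁₀) (hQ₁₁ : Matrix.of (Q₁d 0) = Q₁₁)
    (hQ₂₀ : Matrix.of (Q₂ 0) = Q₂₀) (hQ₂₁ : Matrix.of (Q₂d 0) = Q₂₁) (hG₀ : Matrix.of (G 0) = G₀) (hG₁ : Matrix.of (Gd 0) = G₁)
    (hP₀ : Matrix.of (P 0) = P₀) (hP₁ : Matrix.of (Pd 0) = P₁)
    -- blocks of the inverse of the fine sliced system at `0` and the sliced border jet, NAMED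
    {Γ : Matrix ν ν ℝ} {I : Matrix ν (μ ⊕ ρ₁) ℝ} {L : Matrix (μ ⊕ ρ₁) ν ℝ} {S : Matrix (μ ⊕ ρ₁) (μ ⊕ ρ₁) ℝ} {B : Matrix (μ ⊕ ρ₁) ν ℝ}
    (hΓ : flucCov H₀ (fromRows Q₁₀ τ₁) = Γ) (hI : minOp H₀ (fromRows Q₁₀ τ₁) = I) (hL : minOpL H₀ (fromRows Q₁₀ τ₁) = L) (hS : effForm H₀ (fromRows Q₁₀ τ₁) = S)
    (hB : fromRows Q₁₁ (0 : Matrix ρ₁ ν ℝ) = B)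
    -- (INV): the fine sliced system and the COARSE SLICED system are non-degenerate at `0`
    (h1 : (kkt H₀ (fromRows Q₁₀ τ₁)).det ≠ 0)
    (h2 : (kkt (S.toBlocks₁₁ + G₀) (fromRows Q₂₀ τ₂)).det ≠ 0) :
    secondVar
        (kkt (H₀ + Q₁₀ᵀ * G₀ * Q₁₀) (fromRows (Q₂₀ * Q₁₀) P₀))
        (kkt (H₁₀ + (Q₁₁ᵀ * G₀ * Q₁₀ + Q₁₀ᵀ * G₁ * Q₁₀ + Q₁₀ᵀ * G₀ * Q₁₁)) (fromRows (Q₂₁ * Q₁₀ + Q₂₀ * Q₁₁) P₁))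
        (kkt (H₂ + ((Q₁ddᵀ * G₀ * Q₁₀ + Q₁₁ᵀ * G₁ * Q₁₀ + Q₁₁ᵀ * G₀ * Q₁₁) + (Q₁₁ᵀ * G₁ * Q₁₀ + Q₁₀ᵀ * Gdd * Q₁₀ + Q₁₀ᵀ * G₁ * Q₁₁)
            + (Q₁₁ᵀ * G₀ * Q₁₁ + Q₁₀ᵀ * G₁ * Q₁₁ + Q₁₀ᵀ * G₀ * Q₁dd)))
          (fromRows (Q₂dd * Q₁₀ + Q₂₁ * Q₁₁ + (Q₂₁ * Q₁₁ + Q₂₀ * Q₁dd)) Pdd))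
      = secondVar (kkt H₀ (fromRows Q₁₀ τ₁)) (kkt H₁₀ B) (kkt H₂ (fromRows Q₁dd (0 : Matrix ρ₁ ν ℝ)))
        + secondVar
            (kkt (S.toBlocks₁₁ + G₀) (fromRows Q₂₀ τ₂))
            (kkt (((L * H₁₀ - S * B) * I - L * Bᵀ * S).toBlocks₁₁ + G₁) (fromRows Q₂₁ (0 : Matrix ρ₂ μ ℝ)))
            (kkt ((((-((L * H₁₀ - S * B) * Γ + L * Bᵀ * L) * H₁₀ + L * H₂
                      - (((L * H₁₀ - S * B) * I - L * Bᵀ * S) * B + S * fromRows Q₁dd (0 : Matrix ρ₁ ν ℝ))) * I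
                    + (L * H₁₀ - S * B) * (-((Γ * H₁₀ + I * B) * I - Γ * Bᵀ * S)))
                  - ((-((L * H₁₀ - S * B) * Γ + L * Bᵀ * L) * Bᵀ + L * (fromRows Q₁dd (0 : Matrix ρ₁ ν ℝ))ᵀ) * S
                      + L * Bᵀ * ((L * H₁₀ - S * B) * I - L * Bᵀ * S))).toBlocks₁₁ + Gdd)
              (fromRows Q₂dd (0 : Matrix ρ₂ μ ℝ))) := by
  -- jets at `0` in curve form
  have hQ₁0 : HasDerivAt Q₁ (Q₁d 0) 0 := hQ₁.self_of_nhds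
  have hQ₂0 : HasDerivAt Q₂ (Q₂d 0) 0 := hQ₂.self_of_nhds
  have hG0 : HasDerivAt G (Gd 0) 0 := hG.self_of_nhds
  -- STEP 1: the composite form `𝔎 = H + Q₁ᵀGQ₁`, the composite averaging `𝔔 = Q₂Q₁` and the NESTED comb slice `𝔗 = [τ₂Q₁; τ₁]` as curves with their jets
  have h𝔎 : ∀ᶠ u in 𝓝 (0 : ℝ), HasDerivAt (fun v => Matrix.of.symm (Matrix.of (H v) + (Matrix.of (Q₁ v))ᵀ * Matrix.of (G v) * Matrix.of (Q₁ v)))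
      ((fun u => Matrix.of.symm (Matrix.of (H₁ u) + ((Matrix.of (Q₁d u))ᵀ * Matrix.of (G u) * Matrix.of (Q₁ u)
        + (Matrix.of (Q₁ u))ᵀ * Matrix.of (Gd u) * Matrix.of (Q₁ u) + (Matrix.of (Q₁ u))ᵀ * Matrix.of (G u) * Matrix.of (Q₁d u)))) u) u := by
    filter_upwards [hH, hQ₁, hG] with u huH huQ huG
    have huH' : HasDerivAt H (Matrix.of.symm (Matrix.of (H₁ u))) u := huH
    have huQ' : HasDerivAt Q₁ (Matrix.of.symm (Matrix.of (Q₁d u))) u := huQ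
    have huG' : HasDerivAt G (Matrix.of.symm (Matrix.of (Gd u))) u := huG
    exact hasDerivAt_compFormSliced huH' huQ' huG'
  have h𝔎₁ := hasDerivAt_compForm_curves_jet hH₁ hQ₁0 hQ₁d hG0 hGd
  have h𝔔 : ∀ᶠ u in 𝓝 (0 : ℝ), HasDerivAt (fun v => Matrix.of.symm (Matrix.of (Q₂ v) * Matrix.of (Q₁ v)))
      ((fun u => Matrix.of.symm (Matrix.of (Q₂d u) * Matrix.of (Q₁ u) + Matrix.of (Q₂ u) * Matrix.of (Q₁d u))) u) u := by
    filter_upwards [hQ₁, hQ₂] with u huQ₁ huQ₂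
    have huQ₁' : HasDerivAt Q₁ (Matrix.of.symm (Matrix.of (Q₁d u))) u := huQ₁
    have huQ₂' : HasDerivAt Q₂ (Matrix.of.symm (Matrix.of (Q₂d u))) u := huQ₂
    exact hasDerivAt_matMul huQ₂' huQ₁'
  have h𝔔₁ := hasDerivAt_mul_curves_jet hQ₂0 hQ₂d hQ₁0 hQ₁d
  have h𝔗 : ∀ᶠ u in 𝓝 (0 : ℝ), HasDerivAt (fun v => Matrix.of.symm (fromRows (τ₂ * Matrix.of (Q₁ v)) τ₁))
      ((fun u => Matrix.of.symm (fromRows (τ₂ * Matrix.of (Q₁d u)) (0 : Matrix ρ₁ ν ℝ))) u) u := by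
    filter_upwards [hQ₁] with u huQ₁
    have huQ₁' : HasDerivAt Q₁ (Matrix.of.symm (Matrix.of (Q₁d u))) u := huQ₁
    have h := hasDerivAt_fromRows_const τ₁ (hasDerivAt_const_mul τ₂ huQ₁')
    simp only [Equiv.apply_symm_apply] at h
    exact h
  have h𝔗₁ : HasDerivAt (fun u => Matrix.of.symm (fromRows (τ₂ * Matrix.of (Q₁d u)) (0 : Matrix ρ₁ ν ℝ)))
      (Matrix.of.symm (fromRows (τ₂ * Q₁dd) (0 : Matrix ρ₁ ν ℝ))) 0 := by
    have h := hasDerivAt_fromRows_const (0 : Matrix ρ₁ ν ℝ) (hasDerivAt_const_mul τ₂ hQ₁d)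
    simp only [Equiv.apply_symm_apply] at h
    exact h
  -- the residual gauge generators `W = [D₂|D₁]`: killed by the composite averaging; gauge invariance on `ker Q₂Q₁`; FP moduli `c₂·c₁` (nested comb) and `c'` (one-shot)
  have hQW : ∀ᶠ u in 𝓝 (0 : ℝ), Matrix.of ((fun v => Matrix.of.symm (Matrix.of (Q₂ v) * Matrix.of (Q₁ v))) u)
      * Matrix.of ((fun v => Matrix.of.symm (fromCols (Matrix.of (D₂ v)) (Matrix.of (D₁ v)))) u) = 0 := by
    filter_upwards [hQD₁, hQD₂, hQDbar] with u h1u h2u h3u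
    simp only [Equiv.apply_symm_apply]
    exact compAveraging_mul_gauge_eq_zero _ _ _ _ _ h1u h2u h3u
  have hKW' : ∀ᶠ u in 𝓝 (0 : ℝ), Matrix.of ((fun v => Matrix.of.symm (Matrix.of (H v) + (Matrix.of (Q₁ v))ᵀ * Matrix.of (G v) * Matrix.of (Q₁ v))) u)
      * Matrix.of ((fun v => Matrix.of.symm (fromCols (Matrix.of (D₂ v)) (Matrix.of (D₁ v)))) u)
      = (Matrix.of ((fun v => Matrix.of.symm (Matrix.of (Q₂ v) * Matrix.of (Q₁ v))) u))ᵀ * Matrix.of (Y u) := by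
    filter_upwards [hKW] with u hu
    simpa only [Equiv.apply_symm_apply] using hu
  have hKtW' : ∀ᶠ u in 𝓝 (0 : ℝ), (Matrix.of ((fun v => Matrix.of.symm (Matrix.of (H v) + (Matrix.of (Q₁ v))ᵀ * Matrix.of (G v) * Matrix.of (Q₁ v))) u))ᵀ
      * Matrix.of ((fun v => Matrix.of.symm (fromCols (Matrix.of (D₂ v)) (Matrix.of (D₁ v)))) u)
      = (Matrix.of ((fun v => Matrix.of.symm (Matrix.of (Q₂ v) * Matrix.of (Q₁ v))) u))ᵀ * Matrix.of (Y' u) := by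
    filter_upwards [hKtW] with u hu
    simpa only [Equiv.apply_symm_apply] using hu
  have hτW : ∀ᶠ u in 𝓝 (0 : ℝ), |(Matrix.of ((fun v => Matrix.of.symm (fromRows (τ₂ * Matrix.of (Q₁ v)) τ₁)) u)
      * Matrix.of ((fun v => Matrix.of.symm (fromCols (Matrix.of (D₂ v)) (Matrix.of (D₁ v)))) u)).det| = c₂ * c₁ := by
    filter_upwards [hQD₁, hQD₂, hU₁, hU₂] with u h1u h2u hu1 hu2
    simp only [Equiv.apply_symm_apply]
    exact abs_det_nestedSlice_mul_gauge τ₁ τ₂ _ _ _ _ h1u h2u hu1 hu2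
  have hPW : ∀ᶠ u in 𝓝 (0 : ℝ), |(Matrix.of (P u) * Matrix.of ((fun v => Matrix.of.symm (fromCols (Matrix.of (D₂ v)) (Matrix.of (D₁ v)))) u)).det| = c' := by
    filter_upwards [hU'] with u hu
    simpa only [Equiv.apply_symm_apply] using hu
  have hc : c₂ * c₁ ≠ 0 := mul_ne_zero hc₂ hc₁
  -- the nested-sliced composite system is non-degenerate at `0` (rows regrouped `[Q₂Q₁; [τ₂Q₁; τ₁]]`)
  have h0 : (kkt (Matrix.of ((fun v => Matrix.of.symm (Matrix.of (H v) + (Matrix.of (Q₁ v))ᵀ * Matrix.of (G v) * Matrix.of (Q₁ v))) 0))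
      (fromRows (Matrix.of ((fun v => Matrix.of.symm (Matrix.of (Q₂ v) * Matrix.of (Q₁ v))) 0))
        (Matrix.of ((fun v => Matrix.of.symm (fromRows (τ₂ * Matrix.of (Q₁ v)) τ₁)) 0)))).det ≠ 0 := by
    simp only [Equiv.apply_symm_apply, hH₀, hQ₁₀, hQ₂₀, hG₀]
    rw [fromRows_assoc, det_kkt_reindex]
    exact det_kkt_compSliced_ne_zero H₀ Q₁₀ Q₂₀ G₀ τ₁ τ₂ hS h1 h2
  -- STEP 2: exchange the one-shot slice `P` for the nested comb slice `𝔗` (FP moduli constant ⇒ equal second variations)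
  have hSX := secondVar_kkt_slice_change_of_const h𝔎 h𝔎₁ h𝔔 h𝔔₁ h𝔗 h𝔗₁ hP hPd hKW' hKtW' hQW hτW hPW hc hc' h0
  simp only [Equiv.apply_symm_apply, hH₀, hH₁₀, hQ₁₀, hQ₁₁, hQ₂₀, hQ₂₁, hG₀, hG₁, hP₀, hP₁] at hSX
  -- STEP 3: regroup the rows and apply the nested step law with the corner killed, at the jets at `0`
  rw [hSX, secondVar_kkt_fromRows_assoc]
  exact secondVar_nestedStepLaw_corner H₀ H₁₀ H₂ Q₁₀ Q₁₁ Q₁dd Q₂₀ Q₂₁ Q₂dd G₀ G₁ Gdd τ₁ τ₂ hΓ hI hL hS hB h1 h2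

end Law

end Summit.QuantumFields.BalabanUV.Beta.FP.NestedStepLawOneShot

end
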